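import Literature.AlgebraicGeometry.Resolution.ExtAnnihilatorSupport
import Mathlib.Algebra.Module.FinitePresentation
import HarnessLib

/-!
# The `Ext`-annihilators localize: `Ann_R E^q(M) · R_𝔭 ⊆ Ann_{R_𝔭} E^q(M_𝔭)`

Topic: `Literature/AlgebraicGeometry/Resolution` (globalization of the `Ext`-annihilator ideal
`𝔠 = ∏ Ann E^q` of Theorem A, `SecantColonAnnihilatorExistence.lean`: Kawasaki's global elements
`zᵢ ∈ ∏ Ann Hʲ(Hom(·, D))` [Kawasaki2000, La. 5.3] must land in the *local* ideals `𝔞(𝒪_{X,p}/…)`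
at every closed point, [Kawasaki2000, proof of Thm. 5.1, (2)–(3)]; here is the corresponding
compatibility for our `E^q = F.EMod q`).

For a free resolution `F` of finite type of `M` over a Noetherian ring `R`, a prime `𝔭`, and the
localised resolution `F.localize 𝔭` of `M_𝔭`:

* `FreeResolution.smul_dual_mem_BSub_localize` — if `z` kills `E^{q+1}(F)` then `z/1` times every
  linear form on the localized syzygy `(K_{q+1})_𝔭` extends over `(F_q)_𝔭` (clear denominators with
  `Module.FinitePresentation.exists_lift_of_isLocalizedModule`, extend over `F_q` upstairs, base
  change the extension);
* `FreeResolution.map_annihilator_EMod_le` — `(Ann_R E^{q+1}(F)) R_𝔭 ⊆ Ann_{R_𝔭} E^{q+1}(F.localize 𝔭)`;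
* `FreeResolution.map_prod_annihilator_EMod_le` — the same for the products over any finite set of
  positive indices, and `prod_annihilator_EMod_anti` (more factors, smaller product).

[cite: Kawasaki2000, La. 5.3, proof of Thm. 5.1; Matsumura1987, §19 Lemma 4]
-/

noncomputable section

open CategoryTheory IsLocalRing Module

universe u

namespace Literature.AlgebraicGeometry.Resolution

namespace FreeResolution

variable {R : Type u} [CommRing R] [IsNoetherianRing R] {M : Type u} [AddCommGroup M] [Module R M]
variable (F : FreeResolution R M) (𝔭 : Ideal R) [𝔭.IsPrime]

/-- **Localising an annihilator of `E^{q+1}`.** If `z ∈ Ann_R E^{q+1}(F)` then for every linear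
form `ψ'` on the syzygy `(K_{q+1})_𝔭` of the localised resolution, `(z/1)ψ'` is the restriction of
a linear form on `(F_q)_𝔭`, i.e. `(z/1)ψ' ∈ B^{q+1}(F.localize 𝔭)`. [folklore] -/
theorem smul_dual_mem_BSub_localize (q : ℕ) {z : R}
    (hz : z ∈ Module.annihilator R (F.EMod (q + 1)))
    (ψ' : Dual (Localization.AtPrime 𝔭) ((F.localize 𝔭).syzygyObj (q + 1))) :
    algebraMap R (Localization.AtPrime 𝔭) z • ψ' ∈ (F.localize 𝔭).BSub (q + 1) := by
  have hη := F.isBaseChange_syzygyMap (Localization.AtPrime 𝔭) (LocalizedModule.mkLinearMap 𝔭.primeCompl M)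
    (isBaseChange_mkLinearMap 𝔭) q
  -- the `R`-linear form `y ↦ ψ'(y/1)` on `K_{q+1}` with values in `R_𝔭`; clear denominators
  let g : F.syzygy q →ₗ[R] (Localization.AtPrime 𝔭) :=
    (ψ'.restrictScalars R) ∘ₗ
      ((((F.localize 𝔭).syzygySuccEquiv q).symm.toLinearMap.restrictScalars R) ∘ₗ
        F.syzygyMap (Localization.AtPrime 𝔭) (LocalizedModule.mkLinearMap 𝔭.primeCompl M) (isBaseChange_mkLinearMap 𝔭) q)
  have hg : ∀ y, g y = ψ' (((F.localize 𝔭).syzygySuccEquiv q).symm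
      (F.syzygyMap (Localization.AtPrime 𝔭) (LocalizedModule.mkLinearMap 𝔭.primeCompl M)
        (isBaseChange_mkLinearMap 𝔭) q y)) := fun _ => rfl
  haveI : Module.FinitePresentation R (F.syzygy q) := Module.finitePresentation_of_finite R _
  obtain ⟨ψ, s, hψs⟩ := Module.FinitePresentation.exists_lift_of_isLocalizedModule 𝔭.primeCompl
    (f := Algebra.linearMap R (Localization.AtPrime 𝔭)) g
  have hψ : ∀ y, algebraMap R (Localization.AtPrime 𝔭) (ψ y) = algebraMap R (Localization.AtPrime 𝔭) s * g y := fun y => by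
    have h0 := LinearMap.congr_fun hψs y
    simp only [LinearMap.coe_comp, Function.comp_apply, Algebra.linearMap_apply,
      LinearMap.smul_apply] at h0
    rw [h0, Submonoid.smul_def, Algebra.smul_def]
  -- upstairs: `z ψ ∈ B^{q+1}(F)`, i.e. `z ψ = φ ∘ ι`
  have hzψ : z • (ψ ∘ₗ (F.syzygySuccEquiv q).toLinearMap : Dual R (F.syzygyObj (q + 1))) ∈
      F.BSub (q + 1) := by
    have h0 := Module.mem_annihilator.mp hz
      (Submodule.Quotient.mk (ψ ∘ₗ (F.syzygySuccEquiv q).toLinearMap))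
    rwa [← Submodule.Quotient.mk_smul, Submodule.Quotient.mk_eq_zero] at h0
  obtain ⟨φ, hφ⟩ := (F.mem_BSub_succ_iff q _).mp hzψ
  have hφy : ∀ y : F.syzygy q, φ (y : Fin (F.rank q) → R) = z * ψ y := fun y =>
    LinearMap.congr_fun hφ y
  -- base change `φ` to `φ' : (F_q)_𝔭 → R_𝔭`
  let φ' : (Fin (F.rank q) → (Localization.AtPrime 𝔭)) →ₗ[(Localization.AtPrime 𝔭)] (Localization.AtPrime 𝔭) :=
    (isBaseChange_piAlgebraMap R (Localization.AtPrime 𝔭) (F.rank q)).lift (Algebra.linearMap R (Localization.AtPrime 𝔭) ∘ₗ φ)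
  have hφ' : ∀ v, φ' (piAlgebraMap R (Localization.AtPrime 𝔭) (F.rank q) v) = algebraMap R (Localization.AtPrime 𝔭) (φ v) := fun v =>
    (isBaseChange_piAlgebraMap R (Localization.AtPrime 𝔭) (F.rank q)).lift_eq _ v
  -- `φ' ∘ ι' = (s z / 1) ψ'` on `(K_{q+1})_𝔭`: check on the generators `y/1`
  have key : ((F.localize 𝔭).dualRestrict q φ') ∘ₗ ((F.localize 𝔭).syzygySuccEquiv q).symm.toLinearMap =
      ((algebraMap R (Localization.AtPrime 𝔭) s * algebraMap R (Localization.AtPrime 𝔭) z) • ψ') ∘ₗ ((F.localize 𝔭).syzygySuccEquiv q).symm.toLinearMap := by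
    refine hη.algHom_ext _ _ fun y => ?_
    rw [LinearMap.comp_apply, LinearMap.comp_apply, dualRestrict_apply, LinearMap.smul_apply]
    have h1 : ((F.localize 𝔭).syzygyι q).hom (((F.localize 𝔭).syzygySuccEquiv q).symm.toLinearMap
        (F.syzygyMap (Localization.AtPrime 𝔭) (LocalizedModule.mkLinearMap 𝔭.primeCompl M)
          (isBaseChange_mkLinearMap 𝔭) q y)) =
        piAlgebraMap R (Localization.AtPrime 𝔭) (F.rank q) (y : Fin (F.rank q) → R) := rfl
    rw [h1, hφ', hφy, map_mul, hψ, smul_eq_mul]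
    change algebraMap R (Localization.AtPrime 𝔭) z * (algebraMap R (Localization.AtPrime 𝔭) s * g y) =
      (algebraMap R (Localization.AtPrime 𝔭) s * algebraMap R (Localization.AtPrime 𝔭) z) * g y
    ring
  have hpt : ∀ x, (F.localize 𝔭).dualRestrict q φ' x = (algebraMap R (Localization.AtPrime 𝔭) s * algebraMap R (Localization.AtPrime 𝔭) z) • ψ' x :=
    fun x => by
      have h0 := LinearMap.congr_fun key ((F.localize 𝔭).syzygySuccEquiv q x)
      simpa only [LinearMap.comp_apply, LinearEquiv.coe_toLinearMap,
        LinearEquiv.symm_apply_apply, LinearMap.smul_apply] using h0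
  -- divide by the unit `s/1`
  have hunit : IsUnit (algebraMap R (Localization.AtPrime 𝔭) s) := IsLocalization.map_units (Localization.AtPrime 𝔭) s
  refine ((F.localize 𝔭).mem_BSub_succ_iff q _).mpr ⟨((hunit.unit⁻¹ : (Localization.AtPrime 𝔭)ˣ) : (Localization.AtPrime 𝔭)) • φ', ?_⟩
  ext x
  rw [LinearMap.map_smul, LinearMap.smul_apply, hpt, smul_smul, ← mul_assoc,
    IsUnit.val_inv_mul, one_mul, LinearMap.smul_apply]

/-- **The `Ext`-annihilators localize**: `(Ann_R E^{q+1}(F)) · R_𝔭 ⊆ Ann_{R_𝔭} E^{q+1}(F ⊗ R_𝔭)`.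
[cite: Matsumura1987, §19 Lemma 4] -/
theorem map_annihilator_EMod_le (q : ℕ) :
    (Module.annihilator R (F.EMod (q + 1))).map (algebraMap R (Localization.AtPrime 𝔭)) ≤
      Module.annihilator (Localization.AtPrime 𝔭) ((F.localize 𝔭).EMod (q + 1)) := by
  refine Ideal.map_le_iff_le_comap.mpr fun z hz => ?_
  rw [Ideal.mem_comap, Module.mem_annihilator]
  intro e
  induction e using Submodule.Quotient.induction_on with
  | H ψ' =>
    rw [← Submodule.Quotient.mk_smul, Submodule.Quotient.mk_eq_zero]
    exact F.smul_dual_mem_BSub_localize 𝔭 q hz ψ'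

/-- The products of `Ext`-annihilators over positive indices localize. [folklore] -/
theorem map_prod_annihilator_EMod_le (T : Finset ℕ) (hT : ∀ q ∈ T, 1 ≤ q) :
    (∏ q ∈ T, Module.annihilator R (F.EMod q)).map (algebraMap R (Localization.AtPrime 𝔭)) ≤
      ∏ q ∈ T, Module.annihilator (Localization.AtPrime 𝔭) ((F.localize 𝔭).EMod q) := by
  classical
  induction T using Finset.induction_on with
  | empty => simp
  | insert a T haT ih =>
    rw [Finset.prod_insert haT, Finset.prod_insert haT, Ideal.map_mul]
    refine Ideal.mul_mono ?_ (ih fun q hq => hT q (Finset.mem_insert_of_mem hq))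
    obtain ⟨a', rfl⟩ : ∃ a', a = a' + 1 := ⟨a - 1, by have := hT a (Finset.mem_insert_self a T); omega⟩
    exact F.map_annihilator_EMod_le 𝔭 a'

omit [IsNoetherianRing R] in
/-- More factors, smaller product: `∏_{q ∈ T} Ann E^q ≤ ∏_{q ∈ T'} Ann E^q` for `T' ⊆ T`. [folklore] -/
theorem prod_annihilator_EMod_anti {S' : Type u} [CommRing S'] {N : Type u} [AddCommGroup N]
    [Module S' N] (G : FreeResolution S' N) {T T' : Finset ℕ} (h : T' ⊆ T) :
    (∏ q ∈ T, Module.annihilator S' (G.EMod q)) ≤ ∏ q ∈ T', Module.annihilator S' (G.EMod q) := by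
  classical
  rw [← Finset.prod_sdiff h]
  exact Ideal.mul_le_left

end FreeResolution

end Literature.AlgebraicGeometry.Resolution

end
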